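import Summits.HodgeConjecture.HodgeConjecture.Theorems.HeckePrymWeilHeckePrymAnchorsIsogenyTransfer
import Summits.HodgeConjecture.HodgeConjecture.Theorems.HeckePrymWeilHeckePrymAnchorsPointClassAnchor
import Summits.HodgeConjecture.HodgeConjecture.Theorems.HeckePrymWeilHyperbolicEightfoldsSqrtMinus7HypProd
import Summits.HodgeConjecture.HodgeConjecture.Theorems.HeckePrymWeilHyperbolicEightfoldsSqrtMinus7TensorSurfaceHyperbolic
import Literature.AlgebraicGeometry.HodgeTheory.WeilFamilyFlatSectionsProofs
import Literature.AlgebraicGeometry.HodgeTheory.WeilClassesFourfoldsProofs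
import Literature.AlgebraicGeometry.HodgeTheory.AbelianVarietyEndomorphismsHOne
import Literature.AlgebraicGeometry.Motives.HyperbolicWeilTypeProduct
import Literature.AlgebraicGeometry.Motives.SegreHyperplaneClass
import Literature.AlgebraicGeometry.Motives.AbelianVarietyProductDimProofs
import Literature.NumberTheory.EllipticCurves.CMEndomorphismOfMulMemLattice
import HarnessLib

/-!
# An explicit hyperbolic `√-7`-abelian eightfold with algebraic Weil classes (line `Sketch`, skeleton v10)

Supports the crux item stmt-HodgeConjecture-14642 (`HeckePrymWeil.HyperbolicEightfoldsSqrtMinus7`, route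
route-HodgeConjecture-HeckePrymWeil): the ANCHOR of skeleton v10 of line `Sketch` ("hyperbolic reach"), UNCONDITIONAL.

* `hypAnchor` — an explicit complex abelian EIGHTFOLD `T` with `φ_T ≫ φ_T = -7`, of HYPERBOLIC Weil type in the
  crux's embedded typing (`IsHyperbolicWeilType T φ_T 4 (7·ι^*g + φ_T^*ι^*g)` for a projective embedding `ι` and a
  non-zero rational hyperplane class `g`), whose strong Weil plane `weilClassesOf T φ_T 4 7` is ALGEBRAIC.
  Construction: `E` the CM curve `ℂ/(ℤ + ℤ√-7)` (any elliptic curve would do), the tensor surface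
  `B = (E × E, companion)` (hyperbolic: landed `stub_tensorSurfaceHyperbolic`, p126969), `A₁ = (B × B, ψ × ψ)`
  (hyperbolic: landed `stub_hypProd`, p126764), `T = (A₁ × A₁, α × (-α))` (hyperbolic: `stub_hypProd` with
  `isHyperbolicWeilType_neg`), all under iterated Segre embeddings; `T` is the DIAGONAL point, `K`-isogenous to the
  TENSOR point `(A₁ × A₁, companion)` (`companion_isogenyPair`, from the tree's
  `WeilFamily.diagToCompanion / companionToDiag`), whose Weil plane is algebraic (landed `stub_pointClassAnchor`,
  Deligne's Lemma 4.5: the point class of `A₁`), hence so is that of `T` (landed `stub_isogenyTransfer`).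
* bookkeeping: `(-φ)^* = φ^*` on `H²`, hyperbolicity of `-φ`, the square of the companion, dimensions
  (squares of product endomorphisms: the tree's `prodLift_comp_self_eq_neg_nsmul`).

## References
* [Deligne1982HodgeCycles] P. Deligne (notes by J. S. Milne), Hodge cycles on abelian varieties, LNM 900 (1982),
  Lemma 4.5, Remark 4.10.
* [vanGeemen1994HodgeAV] B. van Geemen, An introduction to the Hodge conjecture for abelian varieties, LNM 1594
  (1994), Lemma 5.2, 5.3–5.4.
* [Andre1996Motifs] Y. André, Pour une théorie inconditionnelle des motifs, Publ. Math. IHÉS 83 (1996), Lemme 6.3.3.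
* [Markman2025SurveySecant] E. Markman, survey, §11.5 Step 1.
* [MumfordAV1970] D. Mumford, Abelian Varieties, §1 (3), §19.
* [LangeBirkenhake1992] H. Lange, Ch. Birkenhake, Complex Abelian Varieties, §1.1.
-/

noncomputable section

set_option linter.dupNamespace false

open CategoryTheory MonoidalCategory CartesianMonoidalCategory AlgebraicGeometry
open Literature.AlgebraicGeometry Literature.AlgebraicGeometry.Motives
  Literature.AlgebraicGeometry.HodgeTheory Literature.AlgebraicTopology.SingularHomology
open Literature.AlgebraicGeometry.Motives.SegreHyperplaneClass
open Summit.HodgeConjecture.HodgeConjecture.Theorems.HeckePrymWeilLine (stub_isogenyTransfer stub_pointClassAnchor)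

namespace Summit.HodgeConjecture.HodgeConjecture.Theorems.HyperbolicEightfoldsSqrtMinus7.HyperbolicReach

/-! ### Bookkeeping: negation, the square of the companion, dimensions, the diagonal ↔ tensor isogeny -/

/-- `-φ = φ ≫ (-(1 • 𝟙 A))`. [cite: MumfordAV1970, §19] -/
theorem neg_eq_comp_neg_one_nsmul_id {A : AbelianVariety ℂ} (φ : A ⟶ A) : -φ = φ ≫ (-((1 : ℕ) • 𝟙 A)) := by
  rw [one_smul, Preadditive.comp_neg, Category.comp_id]

/-- `(-φ)^* = φ^*` on `H²` of an abelian variety (`[-1]^* = 1` on `H² = ⋀² H¹`). [cite: MumfordAV1970, §1 (3)] -/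
theorem complexBetti_map_neg_two {A : AbelianVariety ℂ} (φ : A ⟶ A) (θ : complexBetti A.X 2) :
    complexBetti.map (-φ).hom.hom.hom 2 θ = complexBetti.map φ.hom.hom.hom 2 θ := by
  rw [neg_eq_comp_neg_one_nsmul_id φ]
  change complexBetti.map (φ.hom.hom.hom ≫ (-((1 : ℕ) • 𝟙 A)).hom.hom.hom) 2 θ = _
  rw [complexBetti.map_comp, ModuleCat.comp_apply, complexBetti_map_neg_nsmul_id_two]
  simp

/-- **Hyperbolicity does not see the sign of `φ`**: a `φ^*`-stable frame is `(-φ)^*`-stable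
(`(-φ)^* = -φ^*` on `H¹`, additivity of `f ↦ f^*|_{H¹}`). [cite: LangeBirkenhake1992, §1.1 (p. 19)] -/
theorem isHyperbolicWeilType_neg {A : AbelianVariety ℂ} {φ : A ⟶ A} {n : ℕ} {h : complexBetti A.X 2}
    (hh : IsHyperbolicWeilType A φ n h) : IsHyperbolicWeilType A (-φ) n h := by
  obtain ⟨u, hur, hui, hus, huq⟩ := hh
  refine ⟨u, hur, hui, fun i ↦ ?_, huq⟩
  have hneg : complexBetti.map (-φ).hom.hom.hom 1 (u i) = -complexBetti.map φ.hom.hom.hom 1 (u i) := by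
    rw [complexBetti_map_neg_one]; rfl
  rw [hneg]
  exact Submodule.neg_mem _ (hus i)

/-- **The companion squares to `-d`**: `(x, y) ↦ (-d y, x) ↦ (-d x, -d y)`. [cite: Deligne1982HodgeCycles, Lemma 4.5] -/
theorem companionEnd_comp_self (A₁ : AbelianVariety ℂ) (d : ℕ) :
    WeilFamily.companionEnd A₁ d ≫ WeilFamily.companionEnd A₁ d = -((d : ℤ) • 𝟙 (A₁.prod A₁)) := by
  apply AbelianVariety.prod_hom_ext
  · simp only [Category.assoc, AbelianVariety.prodLift_fst, AbelianVariety.prodLift_snd,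
      Preadditive.neg_comp, Preadditive.zsmul_comp, Category.id_comp, Preadditive.comp_neg,
      Preadditive.comp_zsmul, Category.comp_id]
  · simp only [Category.assoc, AbelianVariety.prodLift_fst, AbelianVariety.prodLift_snd,
      Preadditive.neg_comp, Preadditive.zsmul_comp, Category.id_comp, Preadditive.comp_neg,
      Preadditive.comp_zsmul, Category.comp_id]

/-- `dim (A × B) = 2 (n_A + n_B)` for `dim A = 2 n_A`, `dim B = 2 n_B`. [cite: MumfordAV1970, §19] -/
theorem dim_prod_two_mul {A B : AbelianVariety ℂ} {nA nB : ℕ} (hA : A.dim = 2 * nA) (hB : B.dim = 2 * nB) :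
    (A.prod B).dim = 2 * (nA + nB) := by
  rw [AbelianVariety.dim_prod, hA, hB]; ring

/-- **The diagonal structure `(A₁ × A₁, α × (-α))` is `K`-isogenous to the tensor point
`(A₁ × A₁, companion)`** (registered stub CI of skeleton v9, discharged): for `α ≫ α = -d`, `d ≥ 1`, the tree's
`f_T = WeilFamily.diagToCompanion α d : (u, v) ↦ (d(u + v), α(v - u))` (flat: an isogeny) and
`g_T = WeilFamily.companionToDiag α : (x, y) ↦ (x + αy, x - αy)` satisfy `f_T ≫ g_T = 2d • 𝟙` and
`g_T ≫ diag(α, -α) = companion ≫ g_T` — stated in the orientation consumed by the landed `stub_isogenyTransfer`.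
[cite: Andre1996Motifs, proof of Lemme 6.3.3] [cite: Deligne1982HodgeCycles, Remark 4.10] -/
theorem companion_isogenyPair :
    ∀ (A₁ : AbelianVariety ℂ) (α : A₁ ⟶ A₁) (d : ℕ), 0 < d → α ≫ α = -((d : ℤ) • 𝟙 A₁) →
      ∃ (f : A₁.prod A₁ ⟶ A₁.prod A₁) (g : A₁.prod A₁ ⟶ A₁.prod A₁) (m : ℕ),
        0 < m ∧ f ≫ g = m • 𝟙 (A₁.prod A₁) ∧ Flat f.hom.hom.hom.left ∧
          g ≫ AbelianVariety.prodLift (AbelianVariety.fst A₁ A₁ ≫ α) (AbelianVariety.snd A₁ A₁ ≫ (-α)) =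
            WeilFamily.companionEnd A₁ d ≫ g := by
  intro A₁ α d hd hα
  have h2d : ((2 * (d : ℤ) : ℤ) : ℂ) ≠ 0 := by
    have : (d : ℂ) ≠ 0 := Nat.cast_ne_zero.mpr hd.ne'
    push_cast
    exact mul_ne_zero two_ne_zero this
  refine ⟨WeilFamily.diagToCompanion α d, WeilFamily.companionToDiag α, 2 * d, by positivity, ?_,
    WeilFamily.flat_diagToCompanion hα h2d, WeilFamily.companionToDiag_comp_diagEnd hα⟩
  rw [WeilFamily.diagToCompanion_comp_companionToDiag hα, ← natCast_zsmul]
  push_cast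
  rfl

/-! ### The anchor (unconditional) -/

/-- **The anchor (UNCONDITIONAL): an explicit hyperbolic `√-7`-abelian EIGHTFOLD in the crux's embedded typing
whose strong Weil plane is algebraic.**  Take any complex elliptic curve `E` (the tree's CM curve `ℂ/(ℤ + ℤ√-7)` will do),
the tensor surface `B = (E × E, companion)` (hyperbolic: the landed `stub_tensorSurfaceHyperbolic`), the fourfold `A₁ = (B × B, ψ × ψ)`
(hyperbolic: the landed `stub_hypProd`), and the eightfold `T = (A₁ × A₁, α × (-α))` (hyperbolic: `stub_hypProd` with
`isHyperbolicWeilType_neg`), all under iterated Segre embeddings.  `T` is `K`-isogenous to the tensor point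
`(A₁ × A₁, companion)` (`companion_isogenyPair`), whose strong Weil plane is algebraic (the landed `stub_pointClassAnchor`:
Deligne's Lemma 4.5, the point class of `A₁`), so the Weil plane of `T` is algebraic by the landed
`stub_isogenyTransfer`. [cite: Deligne1982HodgeCycles, Lemma 4.5] [cite: vanGeemen1994HodgeAV, 5.2–5.4]
[cite: Markman2025SurveySecant, §11.5 Step 1] -/
theorem hypAnchor :
    ∃ (T : AbelianVariety ℂ) (φT : T ⟶ T) (eT : ProjectiveEmbedding T.X)
      (aT : complexBetti (projectiveSpace eT.n ℂ) 2),
      T.dim = 2 * 4 ∧ φT ≫ φT = -((7 : ℤ) • 𝟙 T) ∧ IsRationalClass aT ∧ aT ≠ 0 ∧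
      IsHyperbolicWeilType T φT 4
        ((7 : ℂ) • complexBetti.map eT.ι 2 aT + complexBetti.map φT.hom.hom.hom 2 (complexBetti.map eT.ι 2 aT)) ∧
      weilClassesOf T φT 4 7 ≤ algebraicClasses T.X 4 := by
  obtain ⟨g, hgr, hgnz, hgσ⟩ := exists_segreHyperplaneClasses
  obtain ⟨E, ψE, hE, -⟩ :=
    Literature.NumberTheory.EllipticCurves.CMEndomorphism.exists_cmCurve_sqrt_neg_zsmul 7 (by norm_num)
  obtain ⟨M, f₀, hM, hf₀⟩ := exists_closedImmersion_projectiveSpace_pos E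
  haveI := hf₀
  -- the tensor surface
  have hBdim : (E.prod E).dim = 2 * 1 := by rw [AbelianVariety.dim_prod, hE]
  have hB := stub_tensorSurfaceHyperbolic g hgσ E hE M f₀ hf₀ 7 (by norm_num)
  set ιB : (E.prod E).X ⟶ projectiveSpace (M * M + M + M) ℂ := (f₀ ⊗ₘ f₀) ≫ segreEmbedding M M ℂ with hιB
  haveI hιBci : IsClosedImmersion ιB.left := by
    haveI := isClosedImmersion_tensorHom_left (X := E.X) (Y := E.X) f₀ f₀
    rw [hιB]
    change IsClosedImmersion ((f₀ ⊗ₘ f₀).left ≫ (segreEmbedding M M ℂ).left)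
    infer_instance
  -- the fourfold `A₁ = B × B`
  set A₁ : AbelianVariety ℂ := (E.prod E).prod (E.prod E) with hA₁def
  set α : A₁ ⟶ A₁ := AbelianVariety.prodLift (AbelianVariety.fst _ _ ≫ WeilFamily.companionEnd E 7)
      (AbelianVariety.snd _ _ ≫ WeilFamily.companionEnd E 7) with hαdef
  have hA₁dim : A₁.dim = 2 * 2 := dim_prod_two_mul hBdim hBdim
  have hA₁ := stub_hypProd g hgσ (E.prod E) (E.prod E) (WeilFamily.companionEnd E 7) (WeilFamily.companionEnd E 7)
    1 1 _ _ ιB ιB 7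
    Nat.one_pos Nat.one_pos hBdim hBdim hB hB
  set ιA : A₁.X ⟶ projectiveSpace ((M * M + M + M) * (M * M + M + M) + (M * M + M + M) + (M * M + M + M)) ℂ :=
    (ιB ⊗ₘ ιB) ≫ segreEmbedding _ _ ℂ with hιA
  haveI hιAci : IsClosedImmersion ιA.left := by
    haveI := isClosedImmersion_tensorHom_left (X := (E.prod E).X) (Y := (E.prod E).X) ιB ιB
    rw [hιA]
    change IsClosedImmersion ((ιB ⊗ₘ ιB).left ≫ (segreEmbedding _ _ ℂ).left)
    infer_instance
  have hc : WeilFamily.companionEnd E 7 ≫ WeilFamily.companionEnd E 7 = -((7 : ℕ) • 𝟙 (E.prod E)) := by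
    rw [← natCast_zsmul]; exact companionEnd_comp_self E 7
  have hα : α ≫ α = -((7 : ℤ) • 𝟙 A₁) := by
    have h := prodLift_comp_self_eq_neg_nsmul hc hc
    rw [← natCast_zsmul] at h
    exact_mod_cast h
  have hA₁' : IsHyperbolicWeilType A₁ (-α) 2
      (((7 : ℕ) : ℂ) • complexBetti.map ιA 2 (g _) + complexBetti.map (-α).hom.hom.hom 2 (complexBetti.map ιA 2 (g _))) := by
    rw [complexBetti_map_neg_two]
    exact isHyperbolicWeilType_neg hA₁
  -- the eightfold `T = A₁ × A₁` with `α × (-α)`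
  have hTdim : (A₁.prod A₁).dim = 2 * 4 := dim_prod_two_mul hA₁dim hA₁dim
  have hT := stub_hypProd g hgσ A₁ A₁ α (-α) 2 2 _ _ ιA ιA 7 (by norm_num) (by norm_num) hA₁dim hA₁dim hA₁ hA₁'
  set ιT : (A₁.prod A₁).X ⟶ projectiveSpace _ ℂ := (ιA ⊗ₘ ιA) ≫ segreEmbedding _ _ ℂ with hιT
  haveI hιTci : IsClosedImmersion ιT.left := by
    haveI := isClosedImmersion_tensorHom_left (X := A₁.X) (Y := A₁.X) ιA ιA
    rw [hιT]
    change IsClosedImmersion ((ιA ⊗ₘ ιA).left ≫ (segreEmbedding _ _ ℂ).left)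
    infer_instance
  set φT : A₁.prod A₁ ⟶ A₁.prod A₁ :=
    AbelianVariety.prodLift (AbelianVariety.fst A₁ A₁ ≫ α) (AbelianVariety.snd A₁ A₁ ≫ (-α)) with hφTdef
  have hαn : α ≫ α = -((7 : ℕ) • 𝟙 A₁) := by rw [← natCast_zsmul]; exact_mod_cast hα
  have hαn' : (-α) ≫ (-α) = -((7 : ℕ) • 𝟙 A₁) := by rw [Preadditive.neg_comp_neg, hαn]
  have hφT : φT ≫ φT = -((7 : ℤ) • 𝟙 (A₁.prod A₁)) := by
    have h := prodLift_comp_self_eq_neg_nsmul hαn hαn'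
    rw [← natCast_zsmul] at h
    exact_mod_cast h
  -- algebraicity: the tensor point `(A₁ × A₁, companion)` and the diagonal ↔ tensor isogeny pair
  have hA₁dim4 : A₁.dim = 4 := hA₁dim
  have htensor : weilClassesOf (A₁.prod A₁) (WeilFamily.companionEnd A₁ 7) 4 7 ≤ algebraicClasses (A₁.prod A₁).X 4 :=
    stub_pointClassAnchor 7 (by norm_num) (by norm_num) le_rfl 4 A₁ hA₁dim4
  obtain ⟨fθ, gθ, m, hm, hfg, hfflat, hgθ⟩ := companion_isogenyPair A₁ α 7 (by norm_num) hα
  have halg : weilClassesOf (A₁.prod A₁) φT 4 7 ≤ algebraicClasses (A₁.prod A₁).X 4 :=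
    stub_isogenyTransfer 7 4 (A₁.prod A₁) (A₁.prod A₁) φT (WeilFamily.companionEnd A₁ 7) hTdim hTdim hφT
      fθ gθ m hm hfg hfflat hgθ htensor
  have hle : ∀ x : ℕ, x ≤ x * x + x + x := fun x ↦ Nat.le_add_left _ _
  have hn : 1 ≤ ((M * M + M + M) * (M * M + M + M) + (M * M + M + M) + (M * M + M + M)) *
      ((M * M + M + M) * (M * M + M + M) + (M * M + M + M) + (M * M + M + M)) +
      ((M * M + M + M) * (M * M + M + M) + (M * M + M + M) + (M * M + M + M)) +
      ((M * M + M + M) * (M * M + M + M) + (M * M + M + M) + (M * M + M + M)) :=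
    hM.trans ((hle M).trans ((hle _).trans (hle _)))
  refine ⟨A₁.prod A₁, φT, ⟨_, ιT, hιTci⟩, g _, hTdim, hφT, hgr _, hgnz _ hn, ?_, halg⟩
  exact_mod_cast hT

end Summit.HodgeConjecture.HodgeConjecture.Theorems.HyperbolicEightfoldsSqrtMinus7.HyperbolicReach

end
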